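import Literature.AlgebraicGeometry.Frobenioids.MotivatingExamplesSub
import Literature.AlgebraicGeometry.Frobenioids.ArithmeticFrobenioidStandard
import Literature.AlgebraicGeometry.Frobenioids.ArithmeticDivisorScaling
import Literature.AlgebraicGeometry.Frobenioids.GeometricFrobenioidNonDilating
import Literature.AlgebraicGeometry.Frobenioids.GeometricDivisorScaling
import HarnessLib

/-!
# Frobenioids I, §6 sub-DAG (S3): the holder's `_holds` wiring of the sub-nodes typed in
# `MotivatingExamplesSub.lean` onto the proved theorems — PROOF (one-liners)

Mochizuki, *The geometry of Frobenioids I: the general theory*, Kyushu J. Math. **62** (2008) 293–400, §6,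
kurims text pp. 109–116 [cite: MochizukiFrdI2008, Thm. 6.4 (i) p.114].

PROOF-ONLY (seat abc-iut-L6-t10 gen 2, S3 holder; abc-iut-L1-lead R67 (4) / R68 (F): "else HoldsB file by
L6-t10g2"): each row below binds a named sub-node of abc-iut-L1-t1's `MotivatingExamplesSub.lean` (p411133) to
the theorem proving it, so the board rows close BY NAME:
* E63/L05 `Ex63_hypotheses` ← `arith_hypotheses` (ArithmeticFrobenioidHypotheses); E63/L06 `Ex63_isFrobenioid`
  ← `arithFrobenioid_isFrobenioid` (ArithmeticFrobenioidStandard);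
* T64i/L05 `Thm64i_L05_autFixingPlaces`, T64i/L09 `Thm64i_L09_frobCompact_data` ← ArithmeticDivisorScaling;
  T64i/L06 `Thm64i_L06_nonDilating` ← `arithDivisorFunctor_isNonDilatingOn` (ArithmeticFrobenioidNonDilating);
* T62iii/L05 `Thm62iii_L05_nonDilating` ← `geomDivisorFunctor_isNonDilatingOn`; T62iii/L07, L09 ←
  GeometricDivisorScaling;
* T62ii/L03, L04, L06 and T62iii/L06 — the geometric rows — CONDITIONALLY on the saturation property of the
  interface data `Φ(L) = Φ(L)^gp ∩ ℤ_{≥0}[D_L]` (plan/GAP-LEDGER G-L6t10g2-1; L1-lead R68 (F)), as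
  `…_of_subMem` ← GeometricFrobenioidNonDilating.
No definitions; nothing here bears on [IUTchIII] or asserts anything about abc.
-/

noncomputable section

namespace Literature.AlgebraicGeometry.Frobenioids

open CategoryTheory

/-! ### A / D: the arithmetic rows -/

section Arith

variable (F : Type) [Field F] [NumberField F] (K : Type) [Field K] [Algebra F K] [IsGalois F K]

/-- **E63/L05** — the hypotheses of Thm. 5.2 for the data of Ex. 6.3 HOLD. [cite: MochizukiFrdI2008, Ex. 6.3 p.113] -/
theorem Ex63_hypotheses_holds : Ex63_hypotheses F K := arith_hypotheses F K

/-- **E63/L06** — "by Theorem 5.2, (ii), this data determines a [model] Frobenioid": `C_{K/F}` IS a Frobenioid.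
[cite: MochizukiFrdI2008, Ex. 6.3 p.113] -/
theorem Ex63_isFrobenioid_holds : Ex63_isFrobenioid F K := arithFrobenioid_isFrobenioid F K

omit [IsGalois F K] in
/-- **T64i/L06** — "`Φ` is non-dilating" (p. 115 l. 19–20). [cite: MochizukiFrdI2008, Thm. 6.4 (i) p.115] -/
theorem Thm64i_L06_nonDilating_holds : Thm64i_L06_nonDilating F K := arithDivisorFunctor_isNonDilatingOn F K

end Arith

/-- **T64i/L05** — an automorphism of a number field fixing every prime is the identity (p. 115 l. 18–19).
[cite: MochizukiFrdI2008, Thm. 6.4 (i) p.115] -/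
theorem Thm64i_L05_autFixingPlaces_holds : Thm64i_L05_autFixingPlaces := NumberField.autFixingPlaces

/-- **T64i/L09** — the Frobenius-compactness data core "`λ = 1`" (p. 115 l. 22–23).
[cite: MochizukiFrdI2008, Thm. 6.4 (i) p.115] -/
theorem Thm64i_L09_frobCompact_data_holds : Thm64i_L09_frobCompact_data := NumberField.frobCompact_data

/-! ### B / C: the geometric rows -/

section Geom

variable {K : Type} [Field K] {Kt : Type} [Field Kt] [Algebra K Kt] (Γ : GeometricDivisorData K Kt)

/-- **T62iii/L05** — "`Φ` is non-dilating" (p. 112 l. 3), for EVERY `Γ`. [cite: MochizukiFrdI2008, Thm. 6.2 (iii) p.112] -/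
theorem Thm62iii_L05_nonDilating_holds : Thm62iii_L05_nonDilating Γ := geomDivisorFunctor_isNonDilatingOn Γ

/-- **T62iii/L07** — zero/pole decomposition into Cartier effective divisors (p. 112 l. 4–8).
[cite: MochizukiFrdI2008, Thm. 6.2 (iii) p.112] -/
theorem Thm62iii_L07_strictlyRational_data_holds : Thm62iii_L07_strictlyRational_data Γ :=
  Γ.strictlyRational_data

/-- **T62iii/L09** — the Frobenius-compactness data core "`λ = 1`" (p. 112 l. 8–15).
[cite: MochizukiFrdI2008, Thm. 6.2 (iii) p.112] -/
theorem Thm62iii_L09_frobCompact_data_holds : Thm62iii_L09_frobCompact_data Γ := Γ.frobCompact_data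

variable [IsGalois K Kt]

/-- **T62ii/L03**, CONDITIONAL on saturation of `Φ(L)` (GAP-LEDGER G-L6t10g2-1): the hypotheses of Thm. 5.2 for
the data of Ex. 6.1. [cite: MochizukiFrdI2008, Ex. 6.1 p.109] -/
theorem Thm62_geomHypotheses_of_subMem
    (hsub : ∀ (X : FinSubextCat K Kt) (D E : Γ.primeDiv X →₀ ℕ), D ∈ Γ.Phi X → E ∈ Γ.Phi X → E ≤ D →
      D - E ∈ Γ.Phi X) :
    Thm62_geomHypotheses Γ := geom_hypotheses_of Γ hsub

/-- **T62ii/L04**, CONDITIONAL on saturation: `C_{K̃/K}` is a Frobenioid. [cite: MochizukiFrdI2008, Thm. 6.2 p.110] -/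
theorem Thm62_geomIsFrobenioid_of_subMem
    (hsub : ∀ (X : FinSubextCat K Kt) (D E : Γ.primeDiv X →₀ ℕ), D ∈ Γ.Phi X → E ∈ Γ.Phi X → E ≤ D →
      D - E ∈ Γ.Phi X) :
    Thm62_geomIsFrobenioid Γ := geomFrobenioid_isFrobenioid_of Γ hsub

/-- **T62ii/L06**, CONDITIONAL on saturation: Thm. 6.2 (ii) with its Frobenioid premise discharged.
[cite: MochizukiFrdI2008, Thm. 6.2 (ii) p.111] -/
theorem Thm62ii_unconditional_of_subMem (p : ℕ) [Fact p.Prime] [CharP K p]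
    (hsub : ∀ (X : FinSubextCat K Kt) (D E : Γ.primeDiv X →₀ ℕ), D ∈ Γ.Phi X → E ∈ Γ.Phi X → E ≤ D →
      D - E ∈ Γ.Phi X) :
    Thm62ii_unconditional Γ p :=
  ⟨geomFrobenioid_isFrobenioid_of Γ hsub, nonempty_frobeniusPullbackFunctor_iso_of Γ hsub p⟩

/-- **T62iii/L06**, CONDITIONAL on saturation: "hence that `C` is of standard type" (p. 112 l. 3–4).
[cite: MochizukiFrdI2008, Thm. 6.2 (iii) p.112] -/
theorem Thm62iii_L06_standard_of_subMem
    (hsub : ∀ (X : FinSubextCat K Kt) (D E : Γ.primeDiv X →₀ ℕ), D ∈ Γ.Phi X → E ∈ Γ.Phi X → E ≤ D →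
      D - E ∈ Γ.Phi X) :
    Thm62iii_L06_standard Γ := isOfStandardType_geom_of Γ hsub

end Geom

end Literature.AlgebraicGeometry.Frobenioids

end
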